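import Summits.QuantumFields.YangMills.Theorems.UnitScaleTiltProp7SectET3WilsonHessianT3RealityRows
import HarnessLib

/-!
# Route `UnitScaleTilt`, crux «MinimiserStabilityRegPr» (stmt-QuantumFields-19200, stub EX) ∕ (O″χ) B0 (stmt-QuantumFields-20520), node N06(d = 3), route (α) —
# LAYER 0, ROWS OF BRICK L0b, PART 4 (def-free): **THE FIRST DISPLAYED Δ-SLOT ROW OF THE v2.9ˢ REALITY ASSEMBLY — `Δ^η(U₀)` COMMUTES WITH THE REAL STRUCTURE `σ` (pointwise conjugate-transpose)**:
# `DeltaEta U₀ (toL2 Xᴴ) = σ (DeltaEta U₀ (toL2 X))`, hence `Δ^η(U₀)` maps Hermitian-valued fields to Hermitian-valued fields and skew-Hermitian to skew-Hermitian (print: the propagators are REAL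
# operators on `𝔤`-valued fields; `ym-inputs-p03 g2` `REALITY-ROWS-LOCATE-p03g2.md` §2 (L0) «`Δx U₀`: DISPLAYED (two hypotheses on the free slot)» — this is the σ-hypothesis for the letter of record)

Cell `ym-inputs` (desk `pub/ym-inputs`, INPUT-LIST.md v8 §4 row p01; p03 g2's reality reduction §2∕§4).  THEOREMS ONLY (0 `def`, 0 `sorry`); `--supports stmt-QuantumFields-20520 --as helper`; count-neutral.
YM₃ on T³ is ladder rung R3, NOT the Clay problem; nothing here is a claim about a stub, a crux, d = 4 or the mass gap.

THE MECHANISM.  `σ` is anti-unitary for brick L0a's Frobenius-weighted pairing (`inner_toL2_star_left`: `⟪toL2 Zᴴ, toL2 Y⟫ = conj ⟪toL2 Z, toL2 Yᴴ⟫`), and by part 2 (✓`hessFormRe_conj`, ✓`hessFormRe_symm`)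
both `⟪Δ(toL2 Xᴴ), toL2 Y⟫` and `⟪σΔ(toL2 X), toL2 Y⟫` equal `(−2c₀∕η²)·D²A(0)[X, Y]`.

WHAT IS PROVED (member `F`, `n`, `K`, weight `c₀`, background `U₀` — SU(2)-valued, no hypothesis): `inner_toL2_star_left`, ★★★`DeltaEta_toL2_star` (the σ-commutation), ★`DeltaEta_isHermitian`
(`X` pointwise Hermitian ⇒ `toL2⁻¹(Δ^η(U₀)(toL2 X))` pointwise Hermitian), ★`DeltaEta_isSkewHermitian` (same for skew-Hermitian = `𝔲(2)`-valued fields, the route's exponent convention `X = iηA`).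
HONEST SCOPE.  The second displayed slot row (sector preservation: traceless ↦ traceless, scalar ↦ scalar at SU(2) backgrounds — the (3.10)-level identity `W + W⁻¹ = tr W·1`) is NOT in this file.
Nothing of print asserted; no estimate.

References: T. Bałaban, CMP **99** (1985) 389–434 [Balaban1985BackgroundPropagators] ((3.10)–(3.12) p.392, p.393 «complexified Lie algebra»); CMP **102** (1985) 277–309 [Balaban1985Variational] ((51) p.286).
-/

set_option autoImplicit false

noncomputable section

open scoped InnerProductSpace ComplexConjugate Matrix.Norms.L2Operator BigOperators

namespace Summit.QuantumFields.YangMills.Theorems.Prop7SectET3WilsonHessian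

open Literature.MathematicalPhysics.QuantumFieldTheory.Balaban1983to89
open Literature.MathematicalPhysics.QuantumFieldTheory.Balaban1983to89.T3ContinuumYM3Torus
open T3SectALandauChart (eta)
open B11Eq103H1Complex (BondL2K)
open Summit.QuantumFields.YangMills.Theorems.Prop7SectET3Transport (periodsT3)
open Summit.QuantumFields.YangMills.Theorems.Prop7SectET3HilbertLetters (W₂ toL2 inner_toL2)

variable {F : T3Family} {n K : ℕ} {c₀ : ℝ} [Fact (0 < c₀)]

/-- **`σ` IS ANTI-UNITARY FOR THE FROBENIUS-WEIGHTED PAIRING: `⟪toL2 Zᴴ, toL2 Y⟫ = conj ⟪toL2 Z, toL2 Yᴴ⟫`** (`tr(ZY) = conj tr((YZ)ᴴ)`, `tr(ZY) = tr(YZ)`). [cite: Balaban1985BackgroundPropagators, (3.11) p.392] -/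
theorem inner_toL2_star_left (Z Y : PBond (F.P K) 0 → Matrix (Fin 2) (Fin 2) ℂ) :
    ⟪toL2 F K c₀ (star Z), toL2 F K c₀ Y⟫_ℂ = conj ⟪toL2 F K c₀ Z, toL2 F K c₀ (star Y)⟫_ℂ := by
  rw [inner_toL2, inner_toL2, map_mul, Complex.conj_ofReal, map_sum]
  refine congrArg _ (Finset.sum_congr rfl fun b _ => ?_)
  rw [Pi.star_apply, Pi.star_apply, Matrix.star_eq_conjTranspose, Matrix.star_eq_conjTranspose, Matrix.conjTranspose_conjTranspose, ← Matrix.conjTranspose_mul,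
    Matrix.trace_conjTranspose, Complex.star_def, Complex.conj_conj, Matrix.trace_mul_comm]

/-- ★★★ **`Δ^η(U₀)` COMMUTES WITH THE REAL STRUCTURE: `Δ^η(U₀)(toL2 Xᴴ) = toL2 ((toL2⁻¹(Δ^η(U₀)(toL2 X)))ᴴ)`** — the σ-row for the Hessian slot of the v2.9ˢ reality assembly, for the letter of record,
at every SU(2)-valued background. [cite: Balaban1985BackgroundPropagators, (3.10)–(3.12) p.392; Balaban1985Variational, (51) p.286] -/
theorem DeltaEta_toL2_star (U₀ : GaugeField (F.P K) 0 (Matrix.specialUnitaryGroup (Fin 2) ℂ)) (X : PBond (F.P K) 0 → Matrix (Fin 2) (Fin 2) ℂ) :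
    DeltaEta F n K c₀ U₀ (toL2 F K c₀ (star X)) = toL2 F K c₀ (star ((toL2 F K c₀).symm (DeltaEta F n K c₀ U₀ (toL2 F K c₀ X)))) := by
  have hc : conj ((-(2 * (c₀ : ℂ)) / (((eta F n K : ℝ) : ℂ)) ^ 2)) = (-(2 * (c₀ : ℂ)) / (((eta F n K : ℝ) : ℂ)) ^ 2) := by
    rw [map_div₀, map_neg, map_mul, map_pow, map_ofNat, Complex.conj_ofReal, Complex.conj_ofReal]
  refine ext_inner_right ℂ fun w => ?_
  obtain ⟨Y, rfl⟩ : ∃ Y, toL2 F K c₀ Y = w := ⟨(toL2 F K c₀).symm w, (toL2 F K c₀).apply_symm_apply w⟩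
  rw [inner_DeltaEta_left, hessSesqRe_apply, LinearEquiv.symm_apply_apply, LinearEquiv.symm_apply_apply, star_star, inner_toL2_star_left, LinearEquiv.apply_symm_apply,
    inner_DeltaEta_left, hessSesqRe_apply, LinearEquiv.symm_apply_apply, LinearEquiv.symm_apply_apply, map_mul, hc, hessFormRe_conj, star_star, star_star]

/-- ★ **`Δ^η(U₀)` MAPS HERMITIAN-VALUED FIELDS TO HERMITIAN-VALUED FIELDS.** [cite: Balaban1985BackgroundPropagators, (3.12) p.392; Balaban1985Variational, (51) p.286] -/
theorem DeltaEta_isHermitian (U₀ : GaugeField (F.P K) 0 (Matrix.specialUnitaryGroup (Fin 2) ℂ)) {X : PBond (F.P K) 0 → Matrix (Fin 2) (Fin 2) ℂ} (hX : ∀ b, (X b).IsHermitian)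
    (b : PBond (F.P K) 0) : ((toL2 F K c₀).symm (DeltaEta F n K c₀ U₀ (toL2 F K c₀ X)) b).IsHermitian := by
  have hsX : star X = X := funext fun b => (hX b).eq
  have h := DeltaEta_toL2_star (n := n) (c₀ := c₀) U₀ X
  rw [hsX] at h
  have h' := congrArg (fun v => (toL2 F K c₀).symm v b) h
  simp only [LinearEquiv.symm_apply_apply, Pi.star_apply] at h'
  exact h'.symm

/-- ★ **`Δ^η(U₀)` MAPS SKEW-HERMITIAN-VALUED (`𝔲(2)`-VALUED) FIELDS TO SKEW-HERMITIAN-VALUED FIELDS** (the route's exponent convention `X = iηA`). [cite: Balaban1985BackgroundPropagators, (3.12) p.392; Balaban1985Variational, (51) p.286] -/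
theorem DeltaEta_isSkewHermitian (U₀ : GaugeField (F.P K) 0 (Matrix.specialUnitaryGroup (Fin 2) ℂ)) {X : PBond (F.P K) 0 → Matrix (Fin 2) (Fin 2) ℂ} (hX : ∀ b, star (X b) = -X b)
    (b : PBond (F.P K) 0) :
    star ((toL2 F K c₀).symm (DeltaEta F n K c₀ U₀ (toL2 F K c₀ X)) b) = -((toL2 F K c₀).symm (DeltaEta F n K c₀ U₀ (toL2 F K c₀ X)) b) := by
  have hsX : star X = -X := funext fun b => hX b
  have h := DeltaEta_toL2_star (n := n) (c₀ := c₀) U₀ X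
  rw [hsX, map_neg, map_neg] at h
  have h' := congrArg (fun v => (toL2 F K c₀).symm v b) h
  simp only [map_neg, LinearEquiv.symm_apply_apply, Pi.neg_apply, Pi.star_apply] at h'
  simpa [Pi.neg_apply] using h'.symm

end Summit.QuantumFields.YangMills.Theorems.Prop7SectET3WilsonHessian

end
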